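import Summits.ResolutionOfSingularities.ResolutionOfSingularities.Theorems.EquisingularLiftEquisingularLiftSectionOfSmooth
import Literature.NumberTheory.PAdicHodge.FontaineThetaNaturality
import HarnessLib

/-!
# [OURS · L1 W4.5(b) · EL♮(3)] T-JET: sections of a smooth morphism over a complete local base with PRESCRIBED JET —
# every `O/𝔪ⁿ⁺¹`-point (in particular every tangent vector transversal to the special fibre) extends to a section

Support file of the crux chain w45b (cell `res-hironaka`, LADDER-RESOLUTION rung L, slot W4.5(b)), working crux
**EL♮ = `Theses.EquisingularLift.EquisingularLiftNat`** (stmt-ResolutionOfSingularities-20038) and its `n = 3` child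
`EquisingularLiftNatThree` (stmt-ResolutionOfSingularities-20148), registered stub `stub_elnat_three_isolated_nontc`.
OURS; NOT a statement of any manuscript; AI-written, weaker than expert review. Filed
`--supports stmt-ResolutionOfSingularities-20148 --as helper` by res-L1-w45b-stub-3 (self-dealt object T-JET, STATUS
2026-08-27T09:25Z).

WHY. The devices (E-β) (res-L1-w45b-lead-2 LEAD-MEMO-2 §5–§6, res-L1-w45b-stub-4's T-EBETA-CHARTS) and (E-β′) (PLANNER-MEMO v2
M3, this seat's T-EBETA-PRIME) blow up a TRANSVERSAL SECTION `s_q` through a point `q` of the special fibre; the E1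
clause for the next centre is ONE LINEAR CONDITION ON THE FIRST-ORDER JET of `s_q` («`p_s = v_H`», MEMO-2 §6: the
identification `T_qE_O ≅ T_qP_{i,k}` along `T_q s_q` must carry `ℙ(TC_q D)` onto `ℙ(TC_q H_i)`), and MEMO-2 records
«Hensel sections with prescribed tangent vector exist (smooth morphism)». This file proves that sentence in scheme form:
an `O/𝔪²`-point — more generally any `O/I`-point for an ideal `I` of definition — of a smooth `P → Spec O` over a
complete local ring `O` extends to a section.

* `exists_section_of_smooth_of_quotient` — `O` local, `I ≠ ⊤` an ideal with `O` `I`-adically complete, `f : P → Spec O`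
  SMOOTH, `x : Spec(O/I) → P` over `Spec O` ⇒ there is a section `s : Spec O → P` of `f` with `s|_{Spec(O/I)} = x`
  (proof = `exists_section_of_smooth_of_isAdicComplete` with `κ` replaced by `O/I`: `Spec(O/I)` is local, so `x` lands in
  an affine open `V = Spec A`, `A` a smooth `O`-algebra, and the `O`-algebra map `A → O/I` lifts to `A → O` by Mathlib's
  `Algebra.FormallySmooth.exists_mkₐ_comp_eq_of_isAdicComplete` at the ideal `I`);
* **`exists_section_of_smooth_of_jet`** — `O` local and `𝔪`-adically complete, `n : ℕ`: every `O/𝔪ⁿ⁺¹`-point of a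
  smooth `P → Spec O` over `Spec O` (an `n`-JET at a rational point of the special fibre; `n = 1`: a point TOGETHER WITH a
  tangent vector mapping onto the tangent vector of `Spec O`, i.e. transversal to the special fibre) extends to a SECTION
  inducing it (`O` is `𝔪ⁿ⁺¹`-adically complete, `isAdicComplete_of_le_of_pow_le`);
* `exists_section_of_smooth_of_jet_of_subset` — the same for a morphism smooth only on an open `U` containing the
  image (the form of `exists_section_of_smooth`, p-StrataSplit).

References: A. Grothendieck, J. Dieudonné, *EGA IV₄*, Publ. Math. IHÉS 32 (1967), Thm. 18.5.17; H. Matsumura,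
*Commutative Ring Theory* (1986), Thm. 28.10 / proof of 29.2 (successive lifting). Tree inputs:
`…EquisingularLiftSectionOfSmooth` (the `κ`-point case, whose proof is adapted here), Mathlib
`Algebra.FormallySmooth.exists_mkₐ_comp_eq_of_isAdicComplete`, `Literature…isAdicComplete_of_le_of_pow_le`.
-/

set_option linter.dupNamespace false -- mandated namespace `Summit.<Summit>.<Problem>` of this single-conjunct summit

namespace Summit.ResolutionOfSingularities.ResolutionOfSingularities.Cruxes.EquisingularLiftNat.Sections

open CategoryTheory AlgebraicGeometry TopologicalSpace
open IsLocalRing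

universe u

/-- **Hensel's lemma for smooth morphisms with an `O/I`-point prescribed (affine-local form).** Let `O` be a local
ring, `I ≠ O` an ideal for which `O` is `I`-adically complete and separated, `f : P → Spec O` a smooth morphism and
`x : Spec(O/I) → P` a morphism over `Spec O` (`x ≫ f = Spec(O → O/I)`). Then there is a section `s : Spec O → P` of `f`
whose restriction to `Spec(O/I)` is `x`. For `I = 𝔪` this is `exists_section_of_smooth_of_isAdicComplete`; for `I = 𝔪²` it
says that a rational point WITH A PRESCRIBED TRANSVERSAL TANGENT VECTOR extends to a section with that tangent vector.
[cite: Grothendieck1967, Thm. 18.5.17] [OURS · L1 W4.5b] T-JET; NOT a statement of the manuscript. -/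
theorem exists_section_of_smooth_of_quotient (O : Type u) [CommRing O] [IsLocalRing O] (I : Ideal O) (hI : I ≠ ⊤)
    [IsAdicComplete I O] {P : Scheme.{u}} (f : P ⟶ Spec (.of O)) [Smooth f]
    (x : Spec (.of (O ⧸ I)) ⟶ P) (hx : x ≫ f = Spec.map (CommRingCat.ofHom (Ideal.Quotient.mk I))) :
    ∃ s : Spec (.of O) ⟶ P, s ≫ f = 𝟙 _ ∧ Spec.map (CommRingCat.ofHom (Ideal.Quotient.mk I)) ≫ s = x := by
  -- adapted from `exists_section_of_smooth_of_isAdicComplete` (…EquisingularLiftSectionOfSmooth, the case `I = 𝔪`)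
  haveI : Nontrivial (O ⧸ I) := Ideal.Quotient.nontrivial_iff.mpr hI
  haveI : IsLocalRing (O ⧸ I) := IsLocalRing.of_surjective' (Ideal.Quotient.mk I) Ideal.Quotient.mk_surjective
  -- an affine open neighbourhood `V` of the image of the closed point of `Spec(O/I)`
  set p₀ : Spec (.of (O ⧸ I)) := IsLocalRing.closedPoint (O ⧸ I) with hp₀
  obtain ⟨V, hV, hxV, -⟩ :=
    exists_isAffineOpen_mem_and_subset (X := P) (x := x p₀) (U := ⊤) trivial
  -- every point of the local scheme `Spec(O/I)` specialises to the closed point, so `x` lands in `V`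
  have hrange : Set.range x ⊆ Set.range V.ι := by
    rw [Scheme.Opens.range_ι]
    rintro _ ⟨p, rfl⟩
    have hsp : x p ⤳ x p₀ := (IsLocalRing.specializes_closedPoint p).map x.continuous
    exact hsp.mem_open V.isOpen hxV
  -- `x` factors through `V ≅ Spec Γ(P, V)`, i.e. is `Spec` of a ring map `u₀ : Γ(P, V) → O/I`
  obtain ⟨xV, hxVι⟩ : ∃ xV : Spec (.of (O ⧸ I)) ⟶ V, xV ≫ V.ι = x :=
    ⟨_, IsOpenImmersion.lift_fac V.ι x hrange⟩
  obtain ⟨u₀, hu₀⟩ : ∃ u₀ : Γ(P, V) ⟶ CommRingCat.of (O ⧸ I), Spec.map u₀ = xV ≫ hV.isoSpec.hom :=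
    Spec.map_surjective _
  have hxu₀ : Spec.map u₀ ≫ hV.fromSpec = x := by
    rw [hu₀, Category.assoc, IsAffineOpen.isoSpec_hom_fromSpec, hxVι]
  -- `Γ(P, V)` is a smooth `O`-algebra via `φ`
  let φ : O →+* Γ(P, V) := (f.appLE ⊤ V le_top).hom.comp (Scheme.ΓSpecIso (.of O)).inv.hom
  have hφ : φ.Smooth :=
    RingHom.Smooth.comp (RingHom.Smooth.of_bijective
      (Scheme.ΓSpecIso (.of O)).commRingCatIsoToRingEquiv.symm.bijective)
      (f.smooth_appLE (isAffineOpen_top _) hV le_top)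
  letI : Algebra O Γ(P, V) := φ.toAlgebra
  haveI : Algebra.Smooth O Γ(P, V) := hφ
  -- `Spec Γ(P, V) → P → Spec O` is `Spec φ`
  have hfromSpec : hV.fromSpec ≫ f = Spec.map (CommRingCat.ofHom φ) := by
    rw [← IsAffineOpen.SpecMap_appLE_fromSpec f (isAffineOpen_top _) hV le_top,
      IsAffineOpen.fromSpec_top, Scheme.isoSpec_Spec_inv, ← Spec.map_comp]
    rfl
  -- compatibility: `u₀ ∘ φ` is the quotient map, so `u₀` is an `O`-algebra map
  have hcomp : CommRingCat.ofHom φ ≫ u₀ = CommRingCat.ofHom (Ideal.Quotient.mk I) := by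
    apply Spec.map_injective
    rw [Spec.map_comp, ← hfromSpec, ← Category.assoc, hxu₀, hx]
  let u : Γ(P, V) →ₐ[O] O ⧸ I :=
    { u₀.hom with commutes' := fun r => congr(($hcomp).hom r) }
  -- lift `u` to `v : Γ(P, V) →ₐ[O] O` by formal smoothness and `I`-adic completeness
  obtain ⟨v, hv⟩ := Algebra.FormallySmooth.exists_mkₐ_comp_eq_of_isAdicComplete (R := O) (I := I) u
  refine ⟨Spec.map (CommRingCat.ofHom v.toRingHom) ≫ hV.fromSpec, ?_, ?_⟩
  · rw [Category.assoc, hfromSpec, ← Spec.map_comp, Spec.map_eq_id]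
    ext r
    exact v.commutes r
  · rw [← hxu₀, ← Spec.map_comp_assoc]
    congr 2
    ext a
    exact congr($hv a)

/-- **Sections with prescribed `n`-jet.** Let `O` be a local ring, complete and separated for the `𝔪`-adic topology,
`f : P → Spec O` smooth, `n : ℕ`, and `x : Spec(O/𝔪ⁿ⁺¹) → P` a morphism over `Spec O` — an `n`-jet of a section at a
rational point of the special fibre (`n = 0`: a rational point; `n = 1`: a rational point together with a tangent vector
transversal to the special fibre). Then there is a section `s : Spec O → P` of `f` inducing `x` on `Spec(O/𝔪ⁿ⁺¹)`.
[cite: Grothendieck1967, Thm. 18.5.17] [OURS · L1 W4.5b] T-JET (the E1 jet-matching ingredient of (E-β)/(E-β′),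
LEAD-MEMO-2 §6); NOT a statement of the manuscript. -/
theorem exists_section_of_smooth_of_jet (O : Type u) [CommRing O] [IsLocalRing O]
    [IsAdicComplete (maximalIdeal O) O] (n : ℕ) {P : Scheme.{u}} (f : P ⟶ Spec (.of O)) [Smooth f]
    (x : Spec (.of (O ⧸ maximalIdeal O ^ (n + 1))) ⟶ P)
    (hx : x ≫ f = Spec.map (CommRingCat.ofHom (Ideal.Quotient.mk (maximalIdeal O ^ (n + 1))))) :
    ∃ s : Spec (.of O) ⟶ P, s ≫ f = 𝟙 _ ∧
      Spec.map (CommRingCat.ofHom (Ideal.Quotient.mk (maximalIdeal O ^ (n + 1)))) ≫ s = x := by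
  haveI : IsAdicComplete (maximalIdeal O ^ (n + 1)) O :=
    Literature.NumberTheory.PAdicHodge.isAdicComplete_of_le_of_pow_le (I := maximalIdeal O)
      (Ideal.pow_le_self (Nat.succ_ne_zero n)) (e := n + 1) le_rfl
  have hne : maximalIdeal O ^ (n + 1) ≠ ⊤ := fun h =>
    (maximalIdeal.isMaximal O).ne_top (top_le_iff.mp (h ▸ Ideal.pow_le_self (Nat.succ_ne_zero n)))
  exact exists_section_of_smooth_of_quotient O _ hne f x hx

/-- **Sections with prescribed jet, for a morphism smooth along the point.** Let `O` be a local ring, complete and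
separated for the `𝔪`-adic topology, `r₁ : P₁ → Spec O` a morphism smooth on an open `U ⊆ P₁`, and
`x : Spec(O/𝔪ⁿ⁺¹) → P₁` an `n`-jet over `Spec O` with image inside `U`. Then `x` extends to a section `s : Spec O → P₁` of
`r₁` inducing `x`. (The form of `StrataSplit.exists_section_of_smooth`, p-line file, with `κ` replaced by `O/𝔪ⁿ⁺¹`.)
[cite: Grothendieck1967, Thm. 18.5.17] [OURS · L1 W4.5b] T-JET; NOT a statement of the manuscript. -/
theorem exists_section_of_smooth_of_jet_of_subset (O : Type u) [CommRing O] [IsLocalRing O]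
    [IsAdicComplete (maximalIdeal O) O] (n : ℕ) {P₁ : Scheme.{u}} (r₁ : P₁ ⟶ Spec (.of O)) (U : P₁.Opens)
    (hU : Smooth (U.ι ≫ r₁)) (x : Spec (.of (O ⧸ maximalIdeal O ^ (n + 1))) ⟶ P₁)
    (hxU : Set.range x ⊆ (U : Set P₁))
    (hx : x ≫ r₁ = Spec.map (CommRingCat.ofHom (Ideal.Quotient.mk (maximalIdeal O ^ (n + 1))))) :
    ∃ s : Spec (.of O) ⟶ P₁, s ≫ r₁ = 𝟙 _ ∧
      Spec.map (CommRingCat.ofHom (Ideal.Quotient.mk (maximalIdeal O ^ (n + 1)))) ≫ s = x := by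
  -- adapted from `StrataSplit.exists_section_of_smooth`
  haveI := hU
  have hrange : Set.range x ⊆ Set.range U.ι := by rwa [Scheme.Opens.range_ι]
  obtain ⟨xU, hxUι⟩ : ∃ xU : Spec (.of (O ⧸ maximalIdeal O ^ (n + 1))) ⟶ U, xU ≫ U.ι = x :=
    ⟨_, IsOpenImmersion.lift_fac U.ι x hrange⟩
  have hxU' : xU ≫ (U.ι ≫ r₁) = Spec.map (CommRingCat.ofHom (Ideal.Quotient.mk (maximalIdeal O ^ (n + 1)))) := by
    rw [← Category.assoc, hxUι, hx]
  obtain ⟨s, hs, hsx⟩ := exists_section_of_smooth_of_jet O n (U.ι ≫ r₁) xU hxU'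
  refine ⟨s ≫ U.ι, by rw [Category.assoc, hs], ?_⟩
  rw [← Category.assoc, hsx, hxUι]

end Summit.ResolutionOfSingularities.ResolutionOfSingularities.Cruxes.EquisingularLiftNat.Sections
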